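import Literature.Algebra.Homology.HopfTraceFormula
import HarnessLib

/-!
# The abstract Euler–Poincaré principle: additive and multiplicative invariants along a complex shape

Layer `Literature/Algebra/Homology` (pure algebra over Mathlib; proved theorems only, 0 definitions, 0 named facts, no instances, no
notation). Lang, *Algebra* XX §3, Thm. 3.1: for an Euler–Poincaré map `φ` (additive on short exact sequences, values in an abelian group)
and a complex `E` with finitely many non-zero terms, `χ_φ(E) = Σ (−1)ⁱ φ(Eⁱ) = Σ (−1)ⁱ φ(Hⁱ(E)) = χ_φ(H(E))`. The mechanism is shape-generic
and value-generic: a DEGREEWISE decomposition `F i = H i + (a i + b i)` whose boundary terms vanish off `c.Rel` and agree across it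
(`b j = a i` whenever `c.Rel i j`) telescopes in the signed sum. Row `HopfTraceFormula` proved the pairing step
(`finsum_χ_smul_eq_neg_of_pairing`) and ran this mechanism for traces; here it is stated once for ANY additive group `M` (and, through
`Additive G`, for any commutative group `G` with `ℤ`-powers `χ(i) = ±1`), so that dimension (row `EulerPoincareFormula`), trace (row
`HopfTraceFormula`) and characteristic polynomial (row `CharpolyEulerPoincare`) are three instances:

* `finsum_χ_smul_eq_of_degreewise` — `Σᶠ χ(i) • F i = Σᶠ χ(i) • H i` in an additive group;
* `toMul_finsum` — a finite sum in `Additive G` is the finite product in `G`;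
* `finprod_zpow_χ_eq_of_degreewise` — `∏ᶠ (F i)^{χ(i)} = ∏ᶠ (H i)^{χ(i)}` in a commutative group.

Rows `EulerPoincareFormula` / `HopfTraceFormula` are NOT restated or re-derived here. Library only (cell `pub-hodge-ring2`, count-neutral);
proves nothing about any crux, route or conjecture.

## References

* S. Lang, *Algebra* (2002), Ch. XX §3, Thm. 3.1 (Euler–Poincaré maps). [Lang2002]
* A. Hatcher, *Algebraic Topology* (2002), §2.C, proof of Thm. 2C.3 (the telescoping). [HatcherAT2002]
-/

universe w

namespace Literature.Algebra.Homology.HopfTrace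

variable {ι : Type w} {c : ComplexShape ι}

/-- **Euler–Poincaré principle, additive-group values**: a degreewise decomposition `F i = H i + (a i + b i)` whose boundary terms
vanish off `c.Rel` (`b j = 0` without predecessor, `a i = 0` without successor) and agree across it (`b j = a i` for `c.Rel i j`) gives
`Σᶠ χ(i) • F i = Σᶠ χ(i) • H i` (finite supports of `H`, `a`, `b`). [cite: Lang2002, Ch. XX §3, Thm. 3.1] [cite: HatcherAT2002, Thm. 2C.3 (proof)] -/
theorem finsum_χ_smul_eq_of_degreewise [c.EulerCharSigns] {M : Type*} [AddCommGroup M] (F H a b : ι → M)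
    (key : ∀ i, F i = H i + (a i + b i)) (hb : ∀ j, ¬c.Rel (c.prev j) j → b j = 0) (ha : ∀ i, ¬c.Rel i (c.next i) → a i = 0)
    (hab : ∀ i j, c.Rel i j → b j = a i) (hH : H.HasFiniteSupport) (hA : a.HasFiniteSupport) (hB : b.HasFiniteSupport) :
    ∑ᶠ i, (c.χ i : ℤ) • F i = ∑ᶠ i, (c.χ i : ℤ) • H i := by
  have pair := finsum_χ_smul_eq_neg_of_pairing (c := c) a b hb ha hab
  have hs : ∀ {g : ι → M}, g.HasFiniteSupport → (fun i => (c.χ i : ℤ) • g i).HasFiniteSupport := fun {g} hg =>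
    hg.subset (Function.support_smul_subset_right (fun i => (c.χ i : ℤ)) g)
  have key' : ∀ i, (c.χ i : ℤ) • F i = (c.χ i : ℤ) • H i + ((c.χ i : ℤ) • a i + (c.χ i : ℤ) • b i) := fun i => by
    rw [key, smul_add, smul_add]
  have hAB : (fun i => (c.χ i : ℤ) • a i + (c.χ i : ℤ) • b i).HasFiniteSupport := (hs hA).add (hs hB)
  rw [finsum_congr key', finsum_add_distrib (hs hH) hAB, finsum_add_distrib (hs hA) (hs hB), pair, add_neg_cancel, add_zero]

/-- A finite sum in `Additive G` is the corresponding finite product in the commutative group `G`. [cite: Lang2002, Ch. XX §3] -/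
theorem toMul_finsum {α G : Type*} [CommGroup G] (g : α → Additive G) :
    Additive.toMul (∑ᶠ i, g i) = ∏ᶠ i, Additive.toMul (g i) := by
  classical
  by_cases h : (Function.mulSupport fun i => Additive.toMul (g i)).Finite
  · have h' : (Function.support g).Finite := h
    rw [finprod_eq_prod _ h, finsum_eq_sum _ h']
    rfl
  · have h' : (Function.support g).Infinite := h
    rw [finprod_of_infinite_mulSupport h, finsum_of_infinite_support h']
    rfl

/-- **Euler–Poincaré principle, commutative-group values** (`χ(i) = ±1` as `ℤ`-powers): a degreewise factorisation
`F i = H i · (a i · b i)` whose boundary factors are `1` off `c.Rel` and agree across it gives `∏ᶠ (F i)^{χ(i)} = ∏ᶠ (H i)^{χ(i)}`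
(finite supports of `H`, `a`, `b`) — the additive principle in `Additive G`. [cite: Lang2002, Ch. XX §3, Thm. 3.1] -/
theorem finprod_zpow_χ_eq_of_degreewise [c.EulerCharSigns] {G : Type*} [CommGroup G] (F H a b : ι → G)
    (key : ∀ i, F i = H i * (a i * b i)) (hb : ∀ j, ¬c.Rel (c.prev j) j → b j = 1) (ha : ∀ i, ¬c.Rel i (c.next i) → a i = 1)
    (hab : ∀ i j, c.Rel i j → b j = a i) (hH : H.HasFiniteMulSupport) (hA : a.HasFiniteMulSupport) (hB : b.HasFiniteMulSupport) :
    ∏ᶠ i, F i ^ ((c.χ i : ℤ)) = ∏ᶠ i, H i ^ ((c.χ i : ℤ)) := by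
  have h := congrArg Additive.toMul (finsum_χ_smul_eq_of_degreewise (c := c) (M := Additive G) (fun i => Additive.ofMul (F i))
    (fun i => Additive.ofMul (H i)) (fun i => Additive.ofMul (a i)) (fun i => Additive.ofMul (b i)) key hb ha hab hH hA hB)
  rw [toMul_finsum, toMul_finsum] at h
  exact h

end Literature.Algebra.Homology.HopfTrace
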